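import Mathlib

/-!
# Critic certificate (stub-critic g39, card k2-g38 «CONE DENSITY», row 112):
# BOTH typed forms of hypothesis H2 are FALSE AS TYPED — the one-point / `N = ⊤` degenerate instance.

The two `def … : Prop` below are copied VERBATIM from
`Cruxes/SplitBadTwoLowerHalfOfFacts/STUB_IDEAS_stub_heegnerIndexLowerAtTwo_2_g38.lean` ll. 128–148
(namespace `…ConeDensityK2G38`).  Each quantifies over ALL compact Hausdorff totally disconnected `X`
(resp. all such groups `G` and ALL closed subgroups `N`), and asks only Kaplansky's POINTED separation
`x ≠ y → ∃ f ∈ A, f x = 0 ∧ f y ≠ 0`.  On a one-point space (resp. with `N = ⊤`) that hypothesis is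
VACUOUS, `A = 0` qualifies, and the constant function `1` is not within `1/2` of `A`.  Kaplansky's printed
THEOREM [Kaplansky 1950, Proc. AMS 1, p. 357; corpus book:kaplanskynd-selected-papers-other-writings p0072 L5]
has the same tacit `|X| ≥ 2`; the Literature statement must add «for every `x` some `f ∈ D` with `f x ≠ 0`»
(equivalently: `A` separates points AND vanishes identically at no point), after which the theorem is
true and the card's §3 discharges the extra clause from `hsep` + one class outside `rayKer` (or from
`1 ∈` the closure via H3b's infinite-order character).  Consequence for the card's kernel theorems
`isLMeasure_integral_unique` / `integral_avatar_witness_independent` / `forall_of_exists_isLMeasure`: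
their hypothesis `(hK : KaplanskyDensityModN)` is UNSATISFIABLE as typed, so as stated they are
vacuously true; re-typed with the repaired Prop they keep their proofs verbatim (the added clause is
only ever consumed, never produced, inside §3).  No axioms beyond Mathlib's; no `sorry`.
-/

noncomputable section

namespace CriticG39.K2G38

/-- VERBATIM copy of the card's H2 Form A. -/
def KaplanskyStoneWeierstrass : Prop :=
  ∀ (X : Type) [TopologicalSpace X] [CompactSpace X] [T2Space X] [TotallyDisconnectedSpace X]
    (𝕜 : Type) [NontriviallyNormedField 𝕜] [IsUltrametricDist 𝕜]
    (A : NonUnitalSubalgebra 𝕜 C(X, 𝕜)),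
    (∀ x y : X, x ≠ y → ∃ f ∈ A, f x = 0 ∧ f y ≠ 0) →
    ∀ (f : C(X, 𝕜)) (ε : ℝ), 0 < ε → ∃ g ∈ A, ‖f - g‖ ≤ ε

/-- VERBATIM copy of the card's H2 Form B. -/
def KaplanskyDensityModN : Prop :=
  ∀ (G : Type) [Group G] [TopologicalSpace G] [IsTopologicalGroup G] [CompactSpace G] [T2Space G]
    [TotallyDisconnectedSpace G] (N : Subgroup G), IsClosed (N : Set G) →
    ∀ (𝕜 : Type) [NontriviallyNormedField 𝕜] [IsUltrametricDist 𝕜] (A : Submodule 𝕜 (G → 𝕜)),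
    (∀ f ∈ A, Continuous f) →
    (∀ f ∈ A, ∀ σ τ : G, σ⁻¹ * τ ∈ N → f σ = f τ) →
    (∀ f ∈ A, ∀ g ∈ A, f * g ∈ A) →
    (∀ σ τ : G, σ⁻¹ * τ ∉ N → ∃ f ∈ A, f σ = 0 ∧ f τ ≠ 0) →
    ∀ f : G → 𝕜, Continuous f → (∀ σ τ : G, σ⁻¹ * τ ∈ N → f σ = f τ) →
    ∀ ε : ℝ, 0 < ε → ∃ g ∈ A, ∀ σ, ‖f σ - g σ‖ ≤ ε

/-- Form A fails at `X = PUnit`, `𝕜 = ℚ_[2]`, `A = ⊥`, `f = 1`, `ε = 1/2`. -/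
theorem not_kaplanskyStoneWeierstrass : ¬ KaplanskyStoneWeierstrass := by
  intro h
  have hsep : ∀ x y : PUnit, x ≠ y →
      ∃ f ∈ (⊥ : NonUnitalSubalgebra ℚ_[2] C(PUnit, ℚ_[2])), f x = 0 ∧ f y ≠ 0 := by
    intro x y hxy; exact absurd (Subsingleton.elim x y) hxy
  obtain ⟨g, hg, hfg⟩ := h PUnit ℚ_[2] ⊥ hsep 1 (1/2) (by norm_num)
  have hg0 : g = 0 := NonUnitalAlgebra.mem_bot.mp hg
  subst hg0
  rw [sub_zero] at hfg
  have h1 := (1 : C(PUnit.{1}, ℚ_[2])).norm_coe_le_norm PUnit.unit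
  simp only [ContinuousMap.one_apply, norm_one] at h1 hfg
  linarith

/-- Form B fails at `G = PUnit`, `N = ⊤`, `𝕜 = ℚ_[2]`, `A = ⊥`, `f = 1`, `ε = 1/2`. -/
theorem not_kaplanskyDensityModN : ¬ KaplanskyDensityModN := by
  intro h
  have hN : IsClosed ((⊤ : Subgroup PUnit) : Set PUnit) := by simp
  obtain ⟨g, hg, hfg⟩ := h PUnit ⊤ hN ℚ_[2] (⊥ : Submodule ℚ_[2] (PUnit → ℚ_[2]))
    (by intro f hf; rw [(Submodule.mem_bot ℚ_[2]).mp hf]; exact continuous_const)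
    (by intro f hf σ τ _; simp [(Submodule.mem_bot ℚ_[2]).mp hf])
    (by intro f hf g' hg'; rw [(Submodule.mem_bot ℚ_[2]).mp hf, zero_mul]; exact Submodule.zero_mem _)
    (by intro σ τ hστ; exact absurd (Subgroup.mem_top _) hστ)
    (fun _ => (1 : ℚ_[2])) continuous_const (by intro σ τ _; rfl) (1/2) (by norm_num)
  have hg0 : g = 0 := (Submodule.mem_bot ℚ_[2]).mp hg
  subst hg0
  have := hfg PUnit.unit
  simp at this
  linarith

#print axioms not_kaplanskyStoneWeierstrass
#print axioms not_kaplanskyDensityModN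

end CriticG39.K2G38
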